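import Literature.NumberTheory.EllipticCurves.TateModuleFixedPointsProofs
import Literature.NumberTheory.EllipticCurves.TateModuleComparisonProofs
import HarnessLib

/-!
# `codim (V_ℓ E)^{I_𝔓}` from reduction data (Silverman *ATAEC* IV.10.2(a), mult./additive cases)

Sibling proof file (theorems only) assembling `TateModuleFixedPointsProofs`
(`codim (V_ℓ E)^H = 2 - rank_{ℤ_ℓ} T_ℓ(E(F̄)^H)`) and `TateModuleComparisonProofs` (ranks of Tate
modules along finite-index subgroups and reduction maps) into the exact shape of the two
bad-reduction named facts of `HasseWeilAbelianConductor`,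

* `WeierstrassCurve.codimFixed_inertia_rationalTate_eq_one_of_hasMultiplicativeReductionAt`
  (`codim (V_ℓ E)^{I_𝔓} = 1`) and
* `WeierstrassCurve.codimFixed_inertia_rationalTate_eq_two_of_hasAdditiveReductionAt`
  (`codim (V_ℓ E)^{I_𝔓} = 2`),

with the **geometric input of the printed proof made explicit and elementary** (Silverman,
*ATAEC*, proof of Thm. IV.10.2(a), PDF p. 359: the exact sequences
`0 → E₁(K^nr) → E₀(K^nr) → Ẽ_ns(k̄) → 0` and `0 → E₀(K^nr) → E(K^nr) → (finite) → 0`):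
a subgroup `A'` ("`E₀(K^nr)`") of the inertia-fixed points `E(K̄)^{I_𝔓}` ("`E(K^nr)`", as far as
torsion is concerned) of finite exponent-index (`c • E(K̄)^{I_𝔓} ⊆ A'`, `c ≠ 0`: Kodaira–Néron,
*ATAEC* IV.9.2(d)), together with a homomorphism `r` ("reduction") from `A'`

* **onto** the multiplicative group of a separably closed field of characteristic `≠ ℓ`
  ("`Ẽ_ns(k̄) = k̄^*`", AEC VII.5.1(b), VII.2.1) whose kernel ("`E₁(K^nr) ≅ Ê(𝔪)`") has no
  `ℓ`-torsion and is `ℓ`-divisible (AEC VII.2.2 with IV.2.3(b), VII.3.1(a)) — then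
  `codim (V_ℓ E)^{I_𝔓} = 1`
  (`codimFixed_inertia_rationalTate_eq_one_of_reduction`);
* **to** the additive group of a field of characteristic `≠ ℓ` ("`Ẽ_ns(k̄) = k̄⁺`",
  AEC VII.5.1(c)) whose kernel has no `ℓ`-torsion — then `codim (V_ℓ E)^{I_𝔓} = 2`
  (`codimFixed_inertia_rationalTate_eq_two_of_reduction`).

What remains for the two named facts is thus exactly the construction of `E₀ ⊇ E₁` over the
strict henselisation at `𝔓` with these three properties; no Tate-module or representation
theory is left.

## References

* J. H. Silverman, *Advanced Topics in the Arithmetic of Elliptic Curves*, GTM 151 (1994), §IV.10,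
  proof of Thm. 10.2(a), PDF p. 359; Cor. IV.9.2(d). [SilvermanATAEC1994]
* J. H. Silverman, *The Arithmetic of Elliptic Curves*, 2nd ed. (2009), IV.2.3, VII.2.1, VII.3.1,
  VII.5.1. [SilvermanAEC2009]
-/

noncomputable section

open scoped Classical AddSubgroup NumberField
open Field IsDedekindDomain

universe u v

namespace WeierstrassCurve

open Literature.NumberTheory.EllipticCurves Literature.NumberTheory.GaloisRepresentations

section AnyField

variable {F : Type u} [Field F] (W : WeierstrassCurve F) (ℓ : ℕ) [Fact ℓ.Prime]
  {k : Type v} [Field k]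

/-- **Multiplicative shape, any subgroup.**  For an elliptic curve `E/F`, `ℓ ≠ char F`,
`H ≤ Γ_F`: if `E(F̄)^H` has a subgroup `A'` with `c • E(F̄)^H ⊆ A'` (`c ≠ 0`) mapping onto the
multiplicative group of a separably closed field of characteristic `≠ ℓ` with uniquely
`ℓ`-divisible (`ℓ`-torsion-free and `ℓ`-divisible) kernel, then `codim (V_ℓ E)^H = 1`.
Silverman *ATAEC*, proof of IV.10.2(a), PDF p. 359
(`V_ℓ(E(K^nr)) ≃ V_ℓ(E₀(K^nr)) ≃ V_ℓ(k̄^*) ≅ ℚ_ℓ`).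
[cite: SilvermanATAEC1994, proof of Thm. IV.10.2(a), PDF p. 359] -/
theorem codimFixed_rationalTate_eq_one_of_reduction [W.IsElliptic] [IsSepClosed k]
    (hℓ : (ℓ : F) ≠ 0) (hℓk : (ℓ : k) ≠ 0)
    (h : Continuous fun x : absoluteGaloisGroup F × RationalTateModule (geomPoints W) ℓ ↦
      rationalTateRepresentation (absoluteGaloisGroup F) (geomPoints W) ℓ x.1 x.2)
    (H : Subgroup (absoluteGaloisGroup F))
    (A' : AddSubgroup (FixedPoints.addSubgroup H (geomPoints W))) {c : ℕ} (hc : c ≠ 0)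
    (hA' : ∀ P : FixedPoints.addSubgroup H (geomPoints W), c • P ∈ A')
    (r : A' →+ Additive kˣ) (hr : Function.Surjective r)
    (htf : ∀ P : A', r P = 0 → ℓ • P = 0 → P = 0)
    (hdiv : ∀ P : A', r P = 0 → ∃ Q : A', r Q = 0 ∧ ℓ • Q = P) :
    (rationalTateGaloisRepOf (geomPoints W) ℓ h).codimFixed H = 1 := by
  refine (W.codimFixed_rationalTate_eq_one_iff ℓ hℓ h H).mpr ?_
  have hfin : Finite ((FixedPoints.addSubgroup H (geomPoints W))[(ℓ : ℕ)]) :=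
    finite_torsionBy_of_injective (FixedPoints.addSubgroup H (geomPoints W)).subtype
      (fun _ _ h ↦ Subtype.ext h) _ (W.finite_geomTorsion_prime ℓ)
  exact TateModule.finrank_eq_one_of_reduction hfin A' hc hA' hℓk r hr htf hdiv

/-- **Additive shape, any subgroup.**  For an elliptic curve `E/F`, `ℓ ≠ char F`, `H ≤ Γ_F`: if
`E(F̄)^H` has a subgroup `A'` with `c • E(F̄)^H ⊆ A'` (`c ≠ 0`) admitting a homomorphism to the
additive group of a field of characteristic `≠ ℓ` with `ℓ`-torsion-free kernel, then
`(V_ℓ E)^H = 0`, i.e. `codim (V_ℓ E)^H = 2`.  Silverman *ATAEC*, proof of IV.10.2(a), PDF p. 359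
(`V_ℓ(E(K^nr)) ≃ V_ℓ(E₀(K^nr)) ≃ V_ℓ(k̄⁺) = 0`).
[cite: SilvermanATAEC1994, proof of Thm. IV.10.2(a), PDF p. 359] -/
theorem codimFixed_rationalTate_eq_two_of_reduction [W.IsElliptic]
    (hℓ : (ℓ : F) ≠ 0) (hℓk : (ℓ : k) ≠ 0)
    (h : Continuous fun x : absoluteGaloisGroup F × RationalTateModule (geomPoints W) ℓ ↦
      rationalTateRepresentation (absoluteGaloisGroup F) (geomPoints W) ℓ x.1 x.2)
    (H : Subgroup (absoluteGaloisGroup F))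
    (A' : AddSubgroup (FixedPoints.addSubgroup H (geomPoints W))) {c : ℕ} (hc : c ≠ 0)
    (hA' : ∀ P : FixedPoints.addSubgroup H (geomPoints W), c • P ∈ A')
    (r : A' →+ k) (htf : ∀ P : A', r P = 0 → ℓ • P = 0 → P = 0) :
    (rationalTateGaloisRepOf (geomPoints W) ℓ h).codimFixed H = 2 := by
  rw [W.codimFixed_rationalTate_eq_two_sub ℓ hℓ h H]
  have hfin : Finite ((FixedPoints.addSubgroup H (geomPoints W))[(ℓ : ℕ)]) :=
    finite_torsionBy_of_injective (FixedPoints.addSubgroup H (geomPoints W)).subtype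
      (fun _ _ h ↦ Subtype.ext h) _ (W.finite_geomTorsion_prime ℓ)
  rw [TateModule.finrank_eq_zero_of_reduction hfin A' hc hA' hℓk r htf]

end AnyField

section NumberField

variable {K : Type u} [Field K] [NumberField K] (W : WeierstrassCurve K) (ℓ : ℕ) [Fact ℓ.Prime]
  {k : Type v} [Field k]

/-- **Multiplicative case of *ATAEC* IV.10.2(a) from reduction data at `𝔓`.**  For an elliptic
curve `E/K` over a number field, a prime `ℓ`, a prime `𝔓` of `\bar ℤ_K` with inertia group
`I_𝔓 ≤ Γ_K`, and reduction data as in the printed proof — a subgroup `A'` (`E₀`) of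
`E(K̄)^{I_𝔓}` with `c • E(K̄)^{I_𝔓} ⊆ A'`, `c ≠ 0` (*ATAEC* IV.9.2(d)), mapping onto `k̄^*` for a
separably closed field `k̄` with `(ℓ : k̄) ≠ 0` (`Ẽ_ns(k̄)`, multiplicative reduction, AEC
VII.5.1(b), VII.2.1) with uniquely `ℓ`-divisible kernel (`E₁`, AEC VII.2.2 with IV.2.3(b),
VII.3.1(a)) — one has
`codim_{ℚ_ℓ} (V_ℓ E)^{I_𝔓} = 1`, the conclusion of
`codimFixed_inertia_rationalTate_eq_one_of_hasMultiplicativeReductionAt`.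
[cite: SilvermanATAEC1994, proof of Thm. IV.10.2(a), PDF p. 359] -/
theorem codimFixed_inertia_rationalTate_eq_one_of_reduction [W.IsElliptic] [IsSepClosed k]
    (hℓk : (ℓ : k) ≠ 0)
    (h : Continuous fun x : absoluteGaloisGroup K × RationalTateModule (geomPoints W) ℓ ↦
      rationalTateRepresentation (absoluteGaloisGroup K) (geomPoints W) ℓ x.1 x.2)
    (𝔓 : Ideal (absIntegers (𝓞 K) K))
    (A' : AddSubgroup (FixedPoints.addSubgroup (𝔓.inertia (absoluteGaloisGroup K)) (geomPoints W)))
    {c : ℕ} (hc : c ≠ 0)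
    (hA' : ∀ P : FixedPoints.addSubgroup (𝔓.inertia (absoluteGaloisGroup K)) (geomPoints W),
      c • P ∈ A')
    (r : A' →+ Additive kˣ) (hr : Function.Surjective r)
    (htf : ∀ P : A', r P = 0 → ℓ • P = 0 → P = 0)
    (hdiv : ∀ P : A', r P = 0 → ∃ Q : A', r Q = 0 ∧ ℓ • Q = P) :
    (rationalTateGaloisRepOf (geomPoints W) ℓ h).codimFixed (𝔓.inertia (absoluteGaloisGroup K)) =
      1 :=
  W.codimFixed_rationalTate_eq_one_of_reduction ℓ (by exact_mod_cast (Fact.out : ℓ.Prime).ne_zero)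
    hℓk h _ A' hc hA' r hr htf hdiv

/-- **Additive case of *ATAEC* IV.10.2(a) from reduction data at `𝔓`.**  For an elliptic curve
`E/K` over a number field, a prime `ℓ`, a prime `𝔓` of `\bar ℤ_K`, and a subgroup `A'` (`E₀`)
of `E(K̄)^{I_𝔓}` with `c • E(K̄)^{I_𝔓} ⊆ A'`, `c ≠ 0` (*ATAEC* IV.9.2(d)), admitting a
homomorphism to the additive group of a field `k̄` with `(ℓ : k̄) ≠ 0` (`Ẽ_ns(k̄) = k̄⁺`, additive
reduction, AEC VII.5.1(c)) with `ℓ`-torsion-free kernel (`E₁`, AEC VII.3.1(a)): then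
`codim_{ℚ_ℓ} (V_ℓ E)^{I_𝔓} = 2`, the conclusion of
`codimFixed_inertia_rationalTate_eq_two_of_hasAdditiveReductionAt`.
[cite: SilvermanATAEC1994, proof of Thm. IV.10.2(a), PDF p. 359] -/
theorem codimFixed_inertia_rationalTate_eq_two_of_reduction [W.IsElliptic]
    (hℓk : (ℓ : k) ≠ 0)
    (h : Continuous fun x : absoluteGaloisGroup K × RationalTateModule (geomPoints W) ℓ ↦
      rationalTateRepresentation (absoluteGaloisGroup K) (geomPoints W) ℓ x.1 x.2)
    (𝔓 : Ideal (absIntegers (𝓞 K) K))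
    (A' : AddSubgroup (FixedPoints.addSubgroup (𝔓.inertia (absoluteGaloisGroup K)) (geomPoints W)))
    {c : ℕ} (hc : c ≠ 0)
    (hA' : ∀ P : FixedPoints.addSubgroup (𝔓.inertia (absoluteGaloisGroup K)) (geomPoints W),
      c • P ∈ A')
    (r : A' →+ k) (htf : ∀ P : A', r P = 0 → ℓ • P = 0 → P = 0) :
    (rationalTateGaloisRepOf (geomPoints W) ℓ h).codimFixed (𝔓.inertia (absoluteGaloisGroup K)) =
      2 :=
  W.codimFixed_rationalTate_eq_two_of_reduction ℓ (by exact_mod_cast (Fact.out : ℓ.Prime).ne_zero)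
    hℓk h _ A' hc hA' r htf

end NumberField

end WeierstrassCurve
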